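import Literature.Barriers.HodgeConjecture.DecompositionOfTheDiagonalDegreeFourOfGysinHodgeCompatible
import Literature.AlgebraicGeometry.HodgeTheory.ComplexOrientationDegreeFormulaHolds
import HarnessLib

/-!
# Bloch–Srinivas / Voisin II Prop. 10.26 in degree `4` — PROVED

Layer `Literature/Barriers/HodgeConjecture`. DISCHARGE of the named fact
`BlochSrinivas1983_hodgeConjectureDegreeFour_of_chowZeroSupported` (`DecompositionOfTheDiagonal.lean`:
on a smooth projective complex variety whose `CH₀` is supported in dimension `≤ 3`, every rational
`(2,2)`-class of degree `4` is algebraic — Bloch–Srinivas 1983 / Conte–Murre 1978 / Voisin II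
Prop. 10.26 and its proof, p. 306). The tree proved it granted a Gysin / cycle-class formalism with
Hodge-compatible Gysin morphisms (`…_of_gysinHodgeCompatible`); such a formalism now EXISTS
unconditionally (`exists_gysinFormalism_isGysinHodgeCompatible_complexOrientation_holds`: the complex
orientations, Fulton's degree formula and Voisin II Lemma 9.18 being theorems since
`ComplexOrientationDegreeFormulaHolds`).

## References

* [BlochSrinivas1983] S. Bloch, V. Srinivas, Remarks on correspondences and algebraic cycles, Amer. J.
  Math. 105 (1983), Thm. 1 (3).
* [VoisinHodgeII2003] C. Voisin, Hodge Theory and Complex Algebraic Geometry II, Prop. 10.26 and its proof.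
* [ConteMurre1978] A. Conte, J. P. Murre, Math. Ann. 238 (1978).
-/

noncomputable section

namespace Literature.Barriers.HodgeConjecture

open Literature.AlgebraicGeometry.HodgeTheory

/-- **Bloch–Srinivas 1983 / Voisin II Prop. 10.26 in degree `4`, PROVED**: on a smooth projective complex
variety with `CH₀` supported in dimension `≤ 3`, rational `(2,2)`-classes in `H⁴` are algebraic
(discharge of `BlochSrinivas1983_hodgeConjectureDegreeFour_of_chowZeroSupported` through
`…_of_gysinHodgeCompatible` and the unconditional Gysin formalism of the complex orientations).
[cite: BlochSrinivas1983, Thm. 1 (3)] [cite: VoisinHodgeII2003, Prop. 10.26 and its proof] -/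
theorem BlochSrinivas1983_hodgeConjectureDegreeFour_of_chowZeroSupported_holds :
    BlochSrinivas1983_hodgeConjectureDegreeFour_of_chowZeroSupported := by
  obtain ⟨G, hG⟩ := exists_gysinFormalism_isGysinHodgeCompatible_complexOrientation_holds
  exact BlochSrinivas1983_hodgeConjectureDegreeFour_of_chowZeroSupported_of_gysinHodgeCompatible G hG

end Literature.Barriers.HodgeConjecture

end
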